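import Summits.BirchSwinnertonDyer.Rank1Residual.P2.CongruentNumberSilentEvenFiveDatumMonskyEven
import Summits.BirchSwinnertonDyer.Rank1Residual.P2.CongruentNumberSilentEvenFiveEnclosureMonskyEven
import Summits.BirchSwinnertonDyer.Rank1Residual.P2.CongruentNumberEvenFiveFamilyMonskyEven
import HarnessLib

/-!
# Cell `bsd-monsky`: `BSD(E_{2pq}, 2)` on the WHOLE even-five two-prime family `{2pq : p ≡ 5 (mod 8), q ≡ 3 (mod 4)}`
# — both symbol halves from ONE binder set with no Monsky 1990 input: `{hTYZ, hGZK, hR, hMe}` (the landed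
# `𝒮⁺` inputs, Monsky 1990 Cor 5.15 replaced by Heath-Brown 1994's Selmer formula) + route A's system fact
# on `𝒮⁻` (nothing asserted)

HONEST FRAMING (cell `bsd-monsky`, run/shared/lean/pub/bsd-monsky/, README §1: ONE theorem on ONE
explicit infinite family of quadratic twists of the congruent number curve at the prime `2`; not
"BSD for rank ≤ 1", nothing at odd primes, nothing booked until the cross-family referee passes the
written proof). This file asserts NO arithmetic fact; it composes two landed files:
`P2/CongruentNumberEvenFiveFamilyMonskyEven.lean` (the `(p/q) = +1` half — TYZ's genus criterion — with
`hMe` in place of `h515`, and the split of the family by the symbol) and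
`P2/CongruentNumberSilentEvenFiveDatumMonskyEven.lean` + the typer's
`P2/CongruentNumberSilentEvenFiveEnclosureMonskyEven.lean` (the `(p/q) = −1` half `𝒮⁻` — C-P2-1 — from the
odd-index datum, resp. from Tian's CM-point system in its genus form `hSys′`, and `hMe`). The result is
the two-prime even-five family as ONE statement: for ALL primes `p ≡ 5 (mod 8)`, `q ≡ 3 (mod 4)`,
`BSD(E_{2pq}, 2)`, modulo `hTYZ` (TYZ 2017 §3 genus-point data), `hGZK` (Gross–Zagier–Kolyvagin),
`hR` (Rédei–Reichardt), `hMe` (Heath-Brown 1994 appendix) and `hSys′` (Tian's system with its printed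
properties, the referee-admitted restated fact) — no Monsky 1990 binder; with `hD` (PROOF-A App. D) in
place of `hMe` on `𝒮⁻` (`…EnclosureSelmerBound.lean`) the `𝒮⁺` half still needs `hMe` for its Selmer count, so the
mixed form would keep both binders and is not written out.
Nothing asserted; the conjecture `Prop`s stay `@[conjecture]`; no mark moved.

References: [TianYuanZhang2017] Thm. 1.2, Thm. 3.5, §1 (1.1); [Tian2014] Thm. 2.8; [HeathBrown1994SelmerCongruentII]
Appendix (Monsky) p. 41 L20–L36; [Miller2011LMS] Def. 1.1; [Monsky1990MockHeegner] Cor. 5.15 (2′) — NOT used.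
-/

noncomputable section

open scoped Classical

open WeierstrassCurve Literature.NumberTheory.EllipticCurves
  Literature.NumberTheory.EllipticCurves.Rank1Residual
  Literature.NumberTheory.EllipticCurves.Rank1Residual.Typed
  Literature.NumberTheory.EllipticCurves.HeathBrown1994
  Literature.NumberTheory.EllipticCurves.TianYuanZhang2017
  Literature.NumberTheory.QuadraticFields.RedeiReichardt

set_option autoImplicit false

namespace Summit.BirchSwinnertonDyer.Rank1Residual.P2

open Conjectures Literature.NumberTheory.EllipticCurves.Tian2014

/-- **`BSD(E_{2pq}, 2)` for ALL primes `p ≡ 5 (mod 8)`, `q ≡ 3 (mod 4)`, from the datum on `𝒮⁻`** — modulo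
`hTYZ`, `hGZK`, `hR`, `hMe` (the `𝒮⁺` half) and `hmech` (the `𝒮⁻` half); no Monsky 1990 binder. The
`h515`-free twin of `forall_bsdp_two_congruentNumberCurve_two_mul_five_mul_of_oddIndexHeegnerDatum`.
[cite: TianYuanZhang2017, Thm. 1.2, Thm. 3.5 and §1 (1.1)] [cite: HeathBrown1994SelmerCongruentII, Appendix (Monsky), typescript p. 41 L20–L36]
[cite: Miller2011LMS, Def. 1.1 (arXiv:1010.2431 p. 3)] -/
theorem forall_bsdp_two_congruentNumberCurve_two_mul_five_mul_of_oddIndexHeegnerDatum_of_monskyEven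
    (hTYZ : tyz_genusPointData) (hGZK : rank_eq_analyticRank_of_analyticRank_le_one)
    (hR : redeiReichardt_fourTwoCard_classGroup) (hMe : monsky_card_selmerGroup_two_even)
    (hmech : ∀ p q : ℕ, p.Prime → q.Prime → p % 8 = 5 → q % 4 = 3 → jacobiSym p q = -1 →
      OddIndexHeegnerDatum (2 * (p * q))) :
    ∀ p q : ℕ, p.Prime → q.Prime → p % 8 = 5 → q % 4 = 3 →
      BSDp (congruentNumberCurve (2 * (p * q))) 2 :=
  forall_bsdp_two_congruentNumberCurve_two_mul_five_mul_of_conjecture_of_monskyEven hTYZ hGZK hR hMe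
    (congruentSilentEvenFiveBSDTwo_of_oddIndexHeegnerDatum_of_monskyEven hMe hmech)

/-- **`BSD(E_{2pq}, 2)` for ALL primes `p ≡ 5 (mod 8)`, `q ≡ 3 (mod 4)`, from Tian's CM-point system (genus
form) on `𝒮⁻`** — modulo `hTYZ`, `hGZK`, `hR`, `hMe` and `hSys′` (`tian2014_system_sMinus_genus`): the whole
even-five two-prime family with NO Monsky 1990 binder. Conditional; nothing asserted.
[cite: TianYuanZhang2017, Thm. 1.2, Thm. 3.5 and §1 (1.1)] [cite: Tian2014, Thm. 2.8 (arXiv:1210.8231 p0011 L25–L44)]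
[cite: HeathBrown1994SelmerCongruentII, Appendix (Monsky), typescript p. 41 L20–L36] [cite: Miller2011LMS, Def. 1.1 (arXiv:1010.2431 p. 3)] -/
theorem forall_bsdp_two_congruentNumberCurve_two_mul_five_mul_of_genusSystem_of_monskyEven
    (hTYZ : tyz_genusPointData) (hGZK : rank_eq_analyticRank_of_analyticRank_le_one)
    (hR : redeiReichardt_fourTwoCard_classGroup) (hMe : monsky_card_selmerGroup_two_even)
    (hSys' : tian2014_system_sMinus_genus) :
    ∀ p q : ℕ, p.Prime → q.Prime → p % 8 = 5 → q % 4 = 3 →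
      BSDp (congruentNumberCurve (2 * (p * q))) 2 :=
  forall_bsdp_two_congruentNumberCurve_two_mul_five_mul_of_conjecture_of_monskyEven hTYZ hGZK hR hMe
    (congruentSilentEvenFiveBSDTwo_of_genusSystem_of_monskyEven hMe hSys')

end Summit.BirchSwinnertonDyer.Rank1Residual.P2

end
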